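import Literature.AlgebraicTopology.SingularHomology.CollapseMap
import HarnessLib

/-!
# `Hₙ(S) → Hₙ(S | v)` is an isomorphism for a space homeomorphic to `Sⁿ`, in any universe

Topic `Literature/AlgebraicTopology/SingularHomology`; a brick for the fact seat
`provefact-Literature.Topology.FourManifolds.Cobordism.Milnor1965_intersectionNumber_slab` (Milnor,
*Lectures on the h-cobordism theorem* (1965), Lemma 7.2 / Lemma 6.3 in the tree's homological
form: the embedded left-hand sphere `S_L'` lives in the universe of the cobordism, and the
orientation generator `[M] ∈ H_λ(M)` of Lemma 6.3 restricts at each intersection point `pᵢ` to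
the orientation generator `γᵢ` of `H_λ(Uᵢ, Uᵢ - pᵢ)`, PDF p. 37).  The tree proves
`Hₙ(Sⁿ) → Hₙ(Sⁿ | y)` is an isomorphism for the unit sphere
(`Literature.AlgebraicTopology.SingularHomology.isIso_toLocal_sphere`, `CollapseMap.lean`,
Hatcher 2002, §3.3 p. 236); this file moves that along a homeomorphism `Sⁿ ≃ S` with `S` in an
arbitrary universe, by rerunning the exact-sequence argument with `S ∖ v ≅ Sⁿ ∖ pt ≅ ℝⁿ`
contractible:

* `contractibleSpace_compl_singleton_of_homeomorph_sphere` — `S ∖ {v}` is contractible;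
* **`isIso_toLocal_of_homeomorph_sphere`** — `Hₙ(S; M) → Hₙ(S | v; M)` is an isomorphism, `n ≥ 1`;
* `exists_linearEquiv_toLocal_eq_one_of_homeomorph_sphere` — hence a generator of `Hₙ(S; ℤ)`
  restricts to a generator of `Hₙ(S | v; ℤ)`.

Everything is proved; no definitions, no named facts.

## References

* J. Milnor, *Lectures on the h-cobordism theorem*, Princeton (1965), proof of Lemma 6.3
  (PDF p. 37). [MilnorHCobordism1965]
* A. Hatcher, *Algebraic Topology*, CUP 2002, §3.3 p. 236 (Example: `Hₙ(Sⁿ) → Hₙ(Sⁿ | x)` is an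
  isomorphism), §2.1 (exact sequence of the pair). [HatcherAT2002]
-/

noncomputable section

open CategoryTheory Limits Set Function

universe u v

namespace Literature.AlgebraicTopology.SingularHomology

variable (R : Type v) [CommRing R] (M : Type v) [AddCommGroup M] [Module R M]

/-- **The complement of a point in a space homeomorphic to `Sⁿ` is contractible**
(`Sⁿ ∖ pt ≅ ℝⁿ`, `contractibleSpace_sphere_compl_singleton`, moved along the homeomorphism).
[folklore] -/
theorem contractibleSpace_compl_singleton_of_homeomorph_sphere {n : ℕ} {S : Type u}
    [TopologicalSpace S] (φ : (Metric.sphere (0 : EuclideanSpace ℝ (Fin (n + 1))) 1) ≃ₜ S)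
    (v : S) : ContractibleSpace (({v}ᶜ : Set S)) := by
  haveI := contractibleSpace_sphere_compl_singleton (φ.symm v)
  let e : (({φ.symm v}ᶜ : Set (Metric.sphere (0 : EuclideanSpace ℝ (Fin (n + 1))) 1))) ≃ₜ
      (({v}ᶜ : Set S)) :=
    φ.subtype (p := (· ∈ ({φ.symm v}ᶜ : Set _))) (q := (· ∈ ({v}ᶜ : Set S))) fun x => by
      simp only [Set.mem_compl_iff, Set.mem_singleton_iff, not_iff_not]
      exact ⟨fun h => by rw [h, φ.apply_symm_apply], fun h => by rw [← h, φ.symm_apply_apply]⟩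
  exact e.symm.contractibleSpace

/-- **`Hₙ(S; M) → Hₙ(S | v; M)` is an isomorphism for `S` homeomorphic to `Sⁿ`, `n ≥ 1`, and
every `v ∈ S`** (Hatcher 2002, §3.3 p. 236 for `Sⁿ`; the exact sequence of the pair
`(S, S ∖ v)` with `S ∖ v` contractible: `Hₙ(S ∖ v) = 0`, and `Hₙ₋₁(S ∖ v) → Hₙ₋₁(S)` injective —
zero source for `n ≥ 2`, an isomorphism of `H₀`'s of path-connected spaces for `n = 1`).
[cite: HatcherAT2002, §3.3 p. 236] -/
theorem isIso_toLocal_of_homeomorph_sphere {n : ℕ} (hn : n ≠ 0) {S : Type u} [TopologicalSpace S]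
    (φ : (Metric.sphere (0 : EuclideanSpace ℝ (Fin (n + 1))) 1) ≃ₜ S) (v : S) :
    IsIso (singularHomology.toLocal R M v n) := by
  obtain ⟨m, rfl⟩ : ∃ m, n = m + 1 := ⟨n - 1, by omega⟩
  set A : Set S := {v}ᶜ with hA
  haveI : ContractibleSpace A := contractibleSpace_compl_singleton_of_homeomorph_sphere φ v
  haveI : PathConnectedSpace A := inferInstance
  haveI : PathConnectedSpace S := by
    haveI := pathConnectedSpace_sphere (n := m + 1) hn
    exact φ.surjective.pathConnectedSpace φ.continuous
  -- `j_* : Hₙ(S) → Hₙ(S, A)` is `toLocal`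
  change IsIso (relativeSingularHomology.ofAbsolute R M S A (m + 1))
  -- mono: `Hₙ(A) = 0`
  have hmono : Mono (relativeSingularHomology.ofAbsolute R M S A (m + 1)) :=
    (relativeSingularHomology.exact_map_ofAbsolute R M A (m + 1)).mono_g
      ((isZero_singularHomology_of_contractibleSpace R M (X := A) (Nat.succ_ne_zero m)).eq_of_src
        _ _)
  -- epi: `∂ = 0` since `Hₘ(A) → Hₘ(S)` is a monomorphism
  have hι : Mono (singularHomology.map R M
      (⟨Subtype.val, continuous_subtype_val⟩ : C(A, S)) m) := by
    rcases Nat.eq_zero_or_pos m with hm | hm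
    · subst hm
      haveI := singularHomology.isIso_map_zero_of_pathConnectedSpace R M
        (⟨Subtype.val, continuous_subtype_val⟩ : C(A, S))
      infer_instance
    · exact ⟨fun _ _ _ =>
        (isZero_singularHomology_of_contractibleSpace R M (X := A) hm.ne').eq_of_tgt _ _⟩
  have hδ : relativeSingularHomology.δ R M S A m = 0 := by
    rw [← cancel_mono (singularHomology.map R M
      (⟨Subtype.val, continuous_subtype_val⟩ : C(A, S)) m), zero_comp,
      relativeSingularHomology.δ_comp_map]
  have hepi : Epi (relativeSingularHomology.ofAbsolute R M S A (m + 1)) :=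
    (relativeSingularHomology.exact_ofAbsolute_δ R M A m).epi_f hδ
  exact isIso_of_mono_of_epi _

/-- **A generator of `Hₙ(S; ℤ)` restricts to a generator of `Hₙ(S | v; ℤ)`** for `S`
homeomorphic to `Sⁿ`, `n ≥ 1` (Milnor's orientation generator `[M]` restricting to the
orientation generators `γᵢ` at the points `pᵢ`, proof of Lemma 6.3, PDF p. 37).
[cite: MilnorHCobordism1965, proof of Lemma 6.3 (PDF p. 37); HatcherAT2002, §3.3 p. 236] -/
theorem exists_linearEquiv_toLocal_eq_one_of_homeomorph_sphere {n : ℕ} (hn : n ≠ 0)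
    {S : Type u} [TopologicalSpace S]
    (φ : (Metric.sphere (0 : EuclideanSpace ℝ (Fin (n + 1))) 1) ≃ₜ S) (v : S)
    {σ : singularHomology ℤ ℤ S n} (hσ : ∃ e : singularHomology ℤ ℤ S n ≃ₗ[ℤ] ℤ, e σ = 1) :
    ∃ e : localHomology ℤ ℤ S v n ≃ₗ[ℤ] ℤ, e (singularHomology.toLocal ℤ ℤ v n σ) = 1 := by
  haveI := isIso_toLocal_of_homeomorph_sphere ℤ ℤ hn φ v
  obtain ⟨e, he⟩ := hσ
  refine ⟨(asIso (singularHomology.toLocal ℤ ℤ v n)).toLinearEquiv.symm ≪≫ₗ e, ?_⟩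
  have h1 : (asIso (singularHomology.toLocal ℤ ℤ v n)).toLinearEquiv.symm
      (singularHomology.toLocal ℤ ℤ v n σ) = σ :=
    (LinearEquiv.symm_apply_eq _).2 rfl
  rw [LinearEquiv.trans_apply, h1, he]

end Literature.AlgebraicTopology.SingularHomology

end
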